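import Summits.ResolutionOfSingularities.ResolutionOfSingularities.Theorems.FrobeniusClosingSteerWords06SteeredVocab
import Summits.ResolutionOfSingularities.ResolutionOfSingularities.Theorems.FrobeniusClosingSteerSteeredExit
import Summits.ResolutionOfSingularities.ResolutionOfSingularities.Theorems.FrobeniusClosingSteerCore4SteeredRunExistsLiteral
import Summits.ResolutionOfSingularities.ResolutionOfSingularities.Theorems.FrobeniusClosingSteerEmptyStallTwo
import Summits.ResolutionOfSingularities.ResolutionOfSingularities.Theorems.FrobeniusClosingSteerCore4SteeredRegular
import Summits.ResolutionOfSingularities.ResolutionOfSingularities.Theorems.FrobeniusClosingSteerNoEternalChainOne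
import Summits.ResolutionOfSingularities.ResolutionOfSingularities.Theorems.FrobeniusClosingSteerTailCodimBound
import Summits.ResolutionOfSingularities.ResolutionOfSingularities.Theorems.FrobeniusClosingSteerGeoDictFin
import Summits.ResolutionOfSingularities.ResolutionOfSingularities.Theorems.FrobeniusClosingSteerGeoDictResidueField
import Summits.ResolutionOfSingularities.ResolutionOfSingularities.Theorems.FrobeniusClosingSteerSteeredMembersRegular
import Summits.ResolutionOfSingularities.ResolutionOfSingularities.Theorems.FrobeniusClosingSteerPBasisDual
import Summits.ResolutionOfSingularities.ResolutionOfSingularities.Theorems.FrobeniusClosingSteerRadicandChainTwoRealisation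

/-!
# Crux `Steer` (stmt-ResolutionOfSingularities-16345), line `switching-dichotomy` — WORDS 07: §σ2.5–§σ2.12 of the p = 2 σ_top-STEERED COMPOSITION — the adoption leaves X / E / B₂ / M / K-M1 / K(1) / S over the tree, the σ-residual cut by run shape (§σ2.10), the K-slots at finite p-rank and G's p-rank sequel (§σ2.11) (HOIST of the registered skeleton r35 3db2f7fd557b12e8, l.695–962, inside `section SteeredTwo`)

Holder res-L0-w41-lead-1 g5 on res-L0-w41-plan-1 RULING 47 (E1) / 104b; see `…Words01Core` for the hoist protocol (bodies byte for byte;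
`[cite: …]` / `[folklore]` tags on CLOSED `def … : Prop` words are written «(ref. …)» / «(folklore)» — GATE NOTE of `…Words02Stubs`;
cite keys inside `[cite:]` tags normalised to `references.bib` keys where needed, as in `…Words03Phases`).
Nothing here is a statement of the manuscript [claim: Hironaka2017, status: under-review]. OURS (candidates / vocabulary; AI review is
weaker than expert review).
-/

open Summit.ResolutionOfSingularities.ResolutionOfSingularities.Theses.FrobeniusClosing (IsolatedForcedTermination)
open Literature.AlgebraicGeometry.Resolution (IsAbhyankarPlace FGOver exists_ringKrullDim_eq_and_trdeg_eq
  trdeg_eq_trdeg_of_isFractionRing locAtCentre IsQuadraticTransformAlong SubringDominates IsRsopPart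
  LocalUniformization3 RelLocalUniformization CossartPiltant2019General)
open Summit.ResolutionOfSingularities.ResolutionOfSingularities.Theorems.SteerRankThinness
  (HasProperCoarsening concl_of_hasProperCoarsening rankOne_of_not_hasProperCoarsening)
open Summit.ResolutionOfSingularities.ResolutionOfSingularities.Theorems.PfaffLine

set_option linter.dupNamespace false

namespace Summit.ResolutionOfSingularities.ResolutionOfSingularities.Theorems.SwitchingDichotomy.Words

section SteeredTwo

open IsLocalRing
open Literature.AlgebraicGeometry.Resolution (IsLocalBlowupAlong IsQuadraticTransform IsExcellentRing)

variable {K : Type} [Field K]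


/-! ### §σ2.5 adoption leaves for X and E (CERTIFIED against the tree: X p497302 `SteeredExit.concl_of_exit`, E literal
`SteeredRun.steeredRunExists` p499045-sequel; needs the two imports
`…Theorems.FrobeniusClosingSteerSteeredExit` and `…Theorems.FrobeniusClosingSteerCore4SteeredRunExistsLiteral`) -/

/-- X holds (res-D-pv-011's certified recipe, verbatim). -/
theorem steeredExit_holds : SteeredExit :=
  fun p hp n _ k K _ _ _ _ _ O A₀ h₀ t hC R P s N hR0 hrun hexit => by
    obtain ⟨hfg, htp, hfr, -⟩ := hC
    obtain ⟨hs0, -, hst⟩ := hrun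
    obtain ⟨hloc, hsN, hreg⟩ := hexit
    exact _root_.Summit.ResolutionOfSingularities.ResolutionOfSingularities.Theorems.SwitchingDichotomy.SteeredExit.concl_of_exit
      O A₀ h₀ t hfg hfr hp.pos R hR0 s N hs0
      (fun i hi => by
        obtain ⟨_, _, -, hbl, x, g, ⟨⟨hx, -⟩, -, -⟩, hg, he⟩ := hst i hi
        exact ⟨hbl.isLocalBlowup, x, g, hx, hg, he⟩)
      hloc hsN (not_not.mp hreg)

/-- E holds (res-D-pv-012's literal corollary, by `defeq`). -/
theorem steeredRunExists_holds : SteeredRunExists :=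
  _root_.Summit.ResolutionOfSingularities.ResolutionOfSingularities.Theorems.SwitchingDichotomy.SteeredRun.steeredRunExists

/-! ### §σ2.6 B₂ from M (CERTIFIED against the tree: p499359 `EmptyStallTwo.false_of_isSingPrime_two`; needs the import
`…Theorems.FrobeniusClosingSteerEmptyStallTwo`) — so the registered dischargeable at r20 may be `stub_membersRegular :
SteeredMembersRegular` (pure blow-up plumbing, ORDER res-D-pv-036) with `stub_emptyStallTwo := emptyStallTwo_of_membersRegular
stub_membersRegular` DERIVED. -/

/-- **B₂ ⇐ M**: a p = 2 steered stall contradicts the regularity of the member (res-L0-w41-stub-2's theorem, binders = the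
bodies of `SteeredStallAt`). Pure logic + `CharP` transport `k → K`. OURS. [folklore] -/
theorem emptyStallTwo_of_membersRegular (hM : SteeredMembersRegular) : EmptyStallTwo := by
  intro p hp2 n hn k K _i1 _i2 _i3 _i4 _i5 O A₀ h₀ t core R P s N hR0 hrun hstall
  have hp : p.Prime := hp2 ▸ Nat.prime_two
  have hreg : IsRegularLocalRing (R N) := hM p hp n hn k K O A₀ h₀ t core R P s N hR0 hrun
  obtain ⟨hloc, hs, hsing, -, hmult⟩ := hstall
  haveI : CharP K p := charP_of_injective_algebraMap (algebraMap k K).injective p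
  exact _root_.Summit.ResolutionOfSingularities.ResolutionOfSingularities.Theorems.SwitchingDichotomy.EmptyStallTwo.false_of_isSingPrime_two
    p hp2 R s N hreg hs hsing hmult

/-! ### §σ2.7 M from the ONE blow-up kernel K-M1 (ORDER res-D-pv-036 05:27:16Z/05:29:17Z): the skeleton-side unpacking of
`IsSteeredRunUpTo`, kernel-checked, so pv-036's Theses-free `isRegularLocalRing_of_isLocalBlowupAlong` adopts `BlowupStepRegular`
by `exact` and M, B₂ become DERIVED. -/

/-- **K-M1 · BlowupStepRegular** (DISCHARGEABLE, M; Liu Thm 8.1.19 (a) in the local-blowing-up dictionary): the local blowing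
up, with respect to `O`, of a REGULAR local ring `R ⊆ K` along a prime `P` with `R ⧸ P` regular is a regular local ring.
OURS. (ref. Liu2002, Thm. 8.1.19 (a)) (folklore) -/
def BlowupStepRegular : Prop :=
  ∀ (K : Type) [Field K] (O : ValuationSubring K) (R R' : Subring K) [IsLocalRing R] (P : Ideal R) [P.IsPrime],
    IsRegularLocalRing R → IsRegularLocalRing (R ⧸ P) → IsLocalBlowupAlong O R P R' → IsRegularLocalRing R'

/-- **M ⇐ K-M1**: induction along the run; base = the core binder through `isRegularLocalRing_locAtCentre_iff`; a
permissible centre carries `IsRegularLocalRing (R ⧸ P)`, a point step has `R ⧸ 𝔪` a field. Pure logic. OURS. [folklore] -/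
theorem membersRegular_of_step (hS : BlowupStepRegular) : SteeredMembersRegular := by
  intro p hp n hn k K _i1 _i2 _i3 _i4 _i5 O A₀ h₀ t core R P s N hR0 hrun
  obtain ⟨-, htp, -, hreg, -⟩ := core
  have h0 : IsRegularLocalRing (R 0) := by
    rw [hR0]; exact (Literature.AlgebraicGeometry.Resolution.isRegularLocalRing_locAtCentre_iff h₀).mpr hreg
  obtain ⟨-, -, hst⟩ := hrun
  suffices H : ∀ i ≤ N, IsRegularLocalRing (R i) from H N le_rfl
  intro i
  induction i with
  | zero => intro _; exact h0
  | succ i ih =>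
    intro hi
    obtain ⟨hloc, hs, hσ, hbl, -⟩ := hst i (by omega)
    have hRi : IsRegularLocalRing (R i) := ih (by omega)
    rcases hσ with hperm | ⟨hP, -, -⟩
    · obtain ⟨-, ⟨hPr, -⟩, hq, -⟩ := hperm
      exact hS K O (R i) (R (i + 1)) (P i) hRi hq hbl
    · haveI hmax : (P i).IsMaximal := hP ▸ IsLocalRing.maximalIdeal.isMaximal (R i)
      have hq : IsRegularLocalRing ((R i) ⧸ P i) := by
        letI := Ideal.Quotient.field (P i)
        infer_instance
      exact hS K O (R i) (R (i + 1)) (P i) hRi hq hbl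

/-! ### §σ2.8 K-M1 holds (CERTIFIED against the tree: p501181 `SteeredRun.isRegularLocalRing_of_isLocalBlowupAlong_of_quotient`,
res-D-pv-012 AS stub-8; needs the import `…Theorems.FrobeniusClosingSteerCore4SteeredRegular`). With §σ2.5–§σ2.7 the p = 2 σ-line
has NO registered dischargeable left: `stub_R2FourRankOneTwo` is DERIVED from the tree plus the ONE frontier name
`stub_eternalSteeredRunTwo`. -/

/-- K-M1 holds (pv-012's kernel; `P ≤ 𝔪` because `P` is prime, hence proper). -/
theorem blowupStepRegular_holds : BlowupStepRegular := by
  intro K _ O R R' _ P _ hR hq h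
  haveI := hR
  haveI := hq
  exact _root_.Summit.ResolutionOfSingularities.ResolutionOfSingularities.Theorems.SwitchingDichotomy.SteeredRun.isRegularLocalRing_of_isLocalBlowupAlong_of_quotient
    (IsLocalRing.le_maximalIdeal (Ideal.IsPrime.ne_top inferInstance)) h

/-- M holds. -/
theorem steeredMembersRegular_holds : SteeredMembersRegular := membersRegular_of_step blowupStepRegular_holds

/-- B₂ holds. -/
theorem emptyStallTwo_holds : EmptyStallTwo := emptyStallTwo_of_membersRegular steeredMembersRegular_holds

/-- **r20: the p = 2 half of R2 from the tree and ONE frontier name.** -/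
theorem r2FourRankOneTwo_of_frontier (hT : EternalSteeredRunTwo) : R2FourRankOneTwo :=
  r2FourRankOneTwo_of steeredExit_holds steeredRunExists_holds emptyStallTwo_holds hT

/-! ### §σ2.9 K(1) holds (CERTIFIED against the tree: p500126 `NoEternalChainOne.noEternalIsolatedRadicandChain_one`, res-D-pv-011 AS
stub-7; needs the import `…Theorems.FrobeniusClosingSteerNoEternalChainOne`) — the LINE on T with K(1) discharged. -/

/-- K(1) holds (idea-1's codimension-one case: an excellent DVR cannot carry an eternal isolated radicand chain). -/
theorem noEternalIsolatedRadicandChain_one_holds : ∀ p : ℕ, p.Prime → NoEternalIsolatedRadicandChain p 1 :=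
  fun p hp => _root_.Summit.ResolutionOfSingularities.ResolutionOfSingularities.Theorems.SwitchingDichotomy.NoEternalChainOne.noEternalIsolatedRadicandChain_one p hp

/-- **T from its line, K(1) discharged**: open inputs = σ-residual (FRONTIER) · G (pv-011) · TailCodimBound (S) · K(2) (Lipman port,
res-type-026 + o8) · K(3) (idea-1 R3a–R3d). -/
theorem eternalSteeredRunTwo_of_open (hTail : SteeredTailConclTwo) (hG : GeoDict) (hcb : TailCodimBound)
    (hK2 : ∀ p : ℕ, p.Prime → NoEternalIsolatedRadicandChain p 2)
    (hK3 : ∀ p : ℕ, p.Prime → NoEternalIsolatedRadicandChain p 3) : EternalSteeredRunTwo :=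
  eternalSteeredRunTwo_of hTail hG hcb noEternalIsolatedRadicandChain_one_holds hK2 hK3

/-! ### §σ2.10 the σ-RESIDUAL CUT BY RUN SHAPE (for res-L0-w41-strat-2 / idea-3 / tri-3 / k41; helper compositions, NOT stubs):
an eternal steered run with no dominant tail has (PT) eventually only point steps, or (ALT) infinitely many point steps AND
infinitely many positive-dimensional steps, or (WANDER) eventually only positive-dimensional steps whose heights / contractions never
settle into a dominant tail. `steeredTailConclTwo_of_shapes : PointTailConclTwo → AlternationConclTwo → WanderConclTwo →
SteeredTailConclTwo` is the kernel-checked exhaustiveness of the cut (pure logic). Each piece is FRONTIER. -/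

/-- Stage `i` of the run is a POINT STEP (σ_top found no permissible positive-dimensional centre). OURS. [folklore] -/
def IsPointStep (R : ℕ → Subring K) (P : (i : ℕ) → Ideal (R i)) (i : ℕ) : Prop :=
  ∃ _ : IsLocalRing (R i), P i = maximalIdeal (R i)

/-- **PT₁ · PointTailConclTwo** (FRONTIER): p = 2, n = 4, rank one — an eternal steered run that is EVENTUALLY A PURE POINT-STEP RUN
(quadratic transforms along `O` for ever, multiplicity 2 kept, never a permissible curve/surface centre) still yields `Concl`.
(The classical eternal-closed-point case; at p = 2 the cleaned radicand has order exactly 2 at every stage.) OURS.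
(ref. HeinzerEtAl2015, Discussion 4.2) -/
def PointTailConclTwo : Prop :=
  ∀ p : ℕ, p = 2 →
    ∀ (k K : Type) [Field k] [CharP k p] [PerfectField k] [Field K] [Algebra k K]
    (O : ValuationSubring K) (A₀ : Subalgebra k K) (h₀ : A₀.toSubring ≤ O.toSubring) (t : K),
    CoreDatum p 4 k K O A₀ h₀ t → ¬ HasProperCoarsening O →
    ∀ (R : ℕ → Subring K) (P : (i : ℕ) → Ideal (R i)) (s : ℕ → K),
      R 0 = locAtCentre A₀.toSubring O → IsSteeredRun O R P t p s →
      (∃ i₀, ∀ i, i₀ ≤ i → IsPointStep R P i) → Concl O A₀ t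

/-- **ALT₁ · AlternationConclTwo** (FRONTIER): p = 2, n = 4, rank one — an eternal steered run with INFINITELY MANY point steps AND
INFINITELY MANY positive-dimensional steps still yields `Concl` (tri-2's N1 alternates for ever, but on a COMPOSITE valuation: rank one
is the load-bearing binder here). OURS. (ref. CutkoskyMourtada2019, Thm. 7.1) -/
def AlternationConclTwo : Prop :=
  ∀ p : ℕ, p = 2 →
    ∀ (k K : Type) [Field k] [CharP k p] [PerfectField k] [Field K] [Algebra k K]
    (O : ValuationSubring K) (A₀ : Subalgebra k K) (h₀ : A₀.toSubring ≤ O.toSubring) (t : K),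
    CoreDatum p 4 k K O A₀ h₀ t → ¬ HasProperCoarsening O →
    ∀ (R : ℕ → Subring K) (P : (i : ℕ) → Ideal (R i)) (s : ℕ → K),
      R 0 = locAtCentre A₀.toSubring O → IsSteeredRun O R P t p s →
      (∀ i₀, ∃ i, i₀ ≤ i ∧ IsPointStep R P i) → (∀ i₀, ∃ i, i₀ ≤ i ∧ ¬ IsPointStep R P i) → Concl O A₀ t

/-- **WANDER₁ · WanderConclTwo** (FRONTIER): p = 2, n = 4, rank one — an eternal steered run that is EVENTUALLY FREE OF POINT STEPS but
whose positive-dimensional centres never settle into a dominant tail (heights keep changing in {1,2,3}, or the centres stop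
contracting onto each other) still yields `Concl`. OURS. (ref. HeinzerEtAl2015, Discussion 4.2) -/
def WanderConclTwo : Prop :=
  ∀ p : ℕ, p = 2 →
    ∀ (k K : Type) [Field k] [CharP k p] [PerfectField k] [Field K] [Algebra k K]
    (O : ValuationSubring K) (A₀ : Subalgebra k K) (h₀ : A₀.toSubring ≤ O.toSubring) (t : K),
    CoreDatum p 4 k K O A₀ h₀ t → ¬ HasProperCoarsening O →
    ∀ (R : ℕ → Subring K) (P : (i : ℕ) → Ideal (R i)) (s : ℕ → K),
      R 0 = locAtCentre A₀.toSubring O → IsSteeredRun O R P t p s →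
      (∃ i₀, ∀ i, i₀ ≤ i → ¬ IsPointStep R P i) → (¬ ∃ i₀ c : ℕ, 1 ≤ c ∧ IsDominantTail R P i₀ c) → Concl O A₀ t

/-- **The σ-residual from its three shapes** (exhaustiveness of the cut; pure logic). OURS. [folklore] -/
theorem steeredTailConclTwo_of_shapes (hPT : PointTailConclTwo) (hALT : AlternationConclTwo) (hW : WanderConclTwo) :
    SteeredTailConclTwo := by
  intro p hp2 k K _i1 _i2 _i3 _i4 _i5 O A₀ h₀ t core hrank R P s hR0 hrun hnotail
  by_cases hinf : ∀ i₀, ∃ i, i₀ ≤ i ∧ IsPointStep R P i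
  · by_cases hev : ∃ i₀, ∀ i, i₀ ≤ i → IsPointStep R P i
    · exact hPT p hp2 k K O A₀ h₀ t core hrank R P s hR0 hrun hev
    · refine hALT p hp2 k K O A₀ h₀ t core hrank R P s hR0 hrun hinf fun i₀ => ?_
      by_contra hno
      exact hev ⟨i₀, fun i hi => by_contra fun hni => hno ⟨i, hi, hni⟩⟩
  · obtain ⟨i₀, hi₀⟩ : ∃ i₀, ∀ i, i₀ ≤ i → ¬ IsPointStep R P i := by
      by_contra hno
      exact hinf fun i₀ => by_contra fun hne => hno ⟨i₀, fun i hi hps => hne ⟨i, hi, hps⟩⟩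
    exact hW p hp2 k K O A₀ h₀ t core hrank R P s hR0 hrun ⟨i₀, hi₀⟩ hnotail

/-! ### §σ2.11 the K-slots RE-TYPED TO FINITE p-RANK (idea-1 Sketch-idea-1 v5 §7b 651c7cf89f1c20d6, VERBATIM) and G's p-RANK SEQUEL
(plan-1 RULING 05:05:11Z (2), AMENDMENT 05:28:03Z «G verbatim first, p-rank sequel»). `NoEternalIsolatedRadicandChainFin p c` =
K(c) plus ONE hypothesis (a finite derivation family on `κ(S 0)` with common kernel the p-th powers); it is WEAKER than K(c)
(`noEternalIsolatedRadicandChainFin_of`, proved), so every e-free landing (K(1) p500126, K(2) Lipman port) feeds it; K(3) is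
only expected in this form (idea-1: infinite p-rank residue fields escape every `Fin e` derivation tower). The price is on the
G side: `GeoDictFin` must also PRODUCE the residue datum — `κ(S 0) = Frac(R i₀ ⧸ P i₀)` is finitely generated over the perfect
ground field, and `FGFieldPBasisDual` (a dischargeable field-theory kernel: p-basis ⇒ dual derivations with common kernel F^p)
gives the family. -/

/-- **K(c)ᶠⁱⁿ** (idea-1 v5 §7b VERBATIM): no eternal isolated radicand chain in codimension `c` whose first residue field carries a
finite family of derivations with common kernel exactly the `p`-th powers. OURS. [folklore] -/
def NoEternalIsolatedRadicandChainFin (p c : ℕ) : Prop :=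
  ∀ (L : Type) [Field L] [CharP L p] (S : ℕ → Subring L) [∀ m, IsLocalRing (S m)],
    (∃ (e : ℕ) (D : Fin e → Derivation ℤ (ResidueField (S 0)) (ResidueField (S 0))),
        ∀ z : ResidueField (S 0), (∀ l, D l z = 0) ↔ ∃ y : ResidueField (S 0), y ^ p = z) →
    ∀ (hle : ∀ m, S m ≤ S (m + 1)) (f g : ∀ m, S m) (x : ∀ m, S (m + 1)),
    (∀ m, IsRegularLocalRing (S m)) → (∀ m, IsExcellentRing (S m)) → (∀ m, ringKrullDim (S m) = c) →
    (∀ m, IsQuadraticTransform (S m) (S (m + 1))) →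
    (∀ m, Ideal.span ((fun y : S m => (⟨(y : L), hle m y.2⟩ : S (m + 1))) '' (maximalIdeal (S m) : Set (S m)))
        = Ideal.span {x m}) →
    (∀ m, ((f (m + 1) : S (m + 1)) : L) * ((x m : S (m + 1)) : L) ^ p = ((f m : S m) : L) - ((g m : S m) : L) ^ p) →
    (∀ m, ∃ h : S m, f m - h ^ p ∈ maximalIdeal (S m) ^ p) →
    (∀ m, HasIsolatedSingularity (RadicandRing (S m) p (f m))) →
    False

/-- Bookkeeping (PROVED, idea-1): the e-free statement implies the finite-p-rank re-cut. [folklore] -/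
theorem noEternalIsolatedRadicandChainFin_of (p c : ℕ) (h : NoEternalIsolatedRadicandChain p c) :
    NoEternalIsolatedRadicandChainFin p c :=
  fun L _ _ S _ _ => h L S

/-- **G⁺ · GeoDictFin** (DISCHARGEABLE: `GeoDict`'s construction + `FGFieldPBasisDual` on `κ(S 0) = Frac(R i₀ ⧸ P i₀)`, a finitely
generated extension of the perfect ground field): a dominant tail of height `c` yields an eternal isolated radicand chain in
codimension `c` WITH the finite residue derivation datum. OURS. (folklore) -/
def GeoDictFin : Prop :=
  ∀ p : ℕ, p.Prime → ∀ n : ℕ, 4 ≤ n →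
    ∀ (k K : Type) [Field k] [CharP k p] [PerfectField k] [Field K] [Algebra k K]
    (O : ValuationSubring K) (A₀ : Subalgebra k K) (h₀ : A₀.toSubring ≤ O.toSubring) (t : K),
    CoreDatum p n k K O A₀ h₀ t →
    ∀ (R : ℕ → Subring K) (P : (i : ℕ) → Ideal (R i)) (s : ℕ → K) (i₀ c : ℕ),
      R 0 = locAtCentre A₀.toSubring O → IsSteeredRun O R P t p s → IsDominantTail R P i₀ c →
      ¬ NoEternalIsolatedRadicandChainFin p c

/-- G⁺ refines G (PROVED). [folklore] -/
theorem geoDict_of_fin (hG : GeoDictFin) : GeoDict :=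
  fun p hp n hn k K _ _ _ _ _ O A₀ h₀ t core R P s i₀ c hR0 hrun ht hK =>
    hG p hp n hn k K O A₀ h₀ t core R P s i₀ c hR0 hrun ht (noEternalIsolatedRadicandChainFin_of p c hK)

/-- **P · FGFieldPBasisDual** (DISCHARGEABLE field-theory kernel, S/M; for a free λ1 hand — fits res-L0-w41-stub-3's p-degree file):
a finitely generated field extension `F` of a perfect field of characteristic `p` carries a finite family of derivations whose
common kernel is exactly `F^p` (dual basis of a p-basis = separating transcendence basis; `[F : F^p] = p^trdeg`). (folklore) -/
def FGFieldPBasisDual : Prop :=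
  ∀ p : ℕ, p.Prime → ∀ (k F : Type) [Field k] [CharP k p] [PerfectField k] [Field F] [Algebra k F],
    (⊤ : IntermediateField k F).FG →
    ∃ (e : ℕ) (D : Fin e → Derivation ℤ F F), ∀ z : F, (∀ l, D l z = 0) ↔ ∃ y : F, y ^ p = z

/-- **T from its line, finite-p-rank form** (the LINE OF RECORD for the K-side after idea-1 v5): σ-residual + G⁺ + S + K(2)ᶠⁱⁿ +
K(3)ᶠⁱⁿ; K(1) discharged (p500126 via `_of`). Pure logic. OURS. [folklore] -/
theorem eternalSteeredRunTwo_of_fin (hTail : SteeredTailConclTwo) (hG : GeoDictFin) (hcb : TailCodimBound)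
    (hK2 : ∀ p : ℕ, p.Prime → NoEternalIsolatedRadicandChainFin p 2)
    (hK3 : ∀ p : ℕ, p.Prime → NoEternalIsolatedRadicandChainFin p 3) : EternalSteeredRunTwo := by
  intro p hp2 k K _i1 _i2 _i3 _i4 _i5 O A₀ h₀ t core hrank R P s hR0 hrun
  have hp : p.Prime := hp2 ▸ Nat.prime_two
  by_cases htail : ∃ i₀ c : ℕ, 1 ≤ c ∧ IsDominantTail R P i₀ c
  · obtain ⟨i₀, c, hc1, ht⟩ := htail
    have hnc : ¬ NoEternalIsolatedRadicandChainFin p c := hG p hp 4 le_rfl k K O A₀ h₀ t core R P s i₀ c hR0 hrun ht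
    have hc4 : c + 1 ≤ 4 := hcb p hp 4 le_rfl k K O A₀ h₀ t core R P s i₀ c hR0 hrun ht
    have hc3 : c ≤ 3 := by omega
    interval_cases c
    · exact (hnc (noEternalIsolatedRadicandChainFin_of p 1 (noEternalIsolatedRadicandChain_one_holds p hp))).elim
    · exact (hnc (hK2 p hp)).elim
    · exact (hnc (hK3 p hp)).elim
  · exact hTail p hp2 k K O A₀ h₀ t core hrank R P s hR0 hrun htail

/-- … and the K(2) slot fed from the e-free Lipman port when it lands (res-type-026 + o8). [folklore] -/
theorem eternalSteeredRunTwo_of_fin' (hTail : SteeredTailConclTwo) (hG : GeoDictFin) (hcb : TailCodimBound)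
    (hK2 : ∀ p : ℕ, p.Prime → NoEternalIsolatedRadicandChain p 2)
    (hK3 : ∀ p : ℕ, p.Prime → NoEternalIsolatedRadicandChainFin p 3) : EternalSteeredRunTwo :=
  eternalSteeredRunTwo_of_fin hTail hG hcb (fun p hp => noEternalIsolatedRadicandChainFin_of p 2 (hK2 p hp)) hK3

/-! ### §σ2.12 S holds (CERTIFIED against the tree: p502821 `TailCodim.tailCodimBound_of_steeredRun`, res-L0-w41-lead-1; needs the import
`…Theorems.FrobeniusClosingSteerTailCodimBound`) — the LINE on T shrinks to σ-residual + G⁺ + K(2) + K(3). -/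

/-- S holds (lead-1's kernel; `Perm := IsPermissibleCentre`, primality from `IsTopSingComponent`, non-maximality its first field). -/
theorem tailCodimBound_holds : TailCodimBound := by
  intro p hp n hn k K _i1 _i2 _i3 _i4 _i5 O A₀ h₀ t core R P s i₀ c hR0 hrun ht
  obtain ⟨hfg, htp, hK0, hreg, hmax, h0, hdim, hnA, hnDA, hnDisc, hδ, hc, htr, hreg3⟩ := core
  exact _root_.Summit.ResolutionOfSingularities.ResolutionOfSingularities.Theorems.SwitchingDichotomy.TailCodim.tailCodimBound_of_steeredRun
    (fun S hS f Q => @IsPermissibleCentre K _ S hS p f Q) p (fun S hS f Q h => ⟨h.2.1.elim fun hQ _ => hQ, h.1⟩)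
    O A₀ h₀ hfg htr R P s hR0 hrun.2 i₀ c ht

/-- **T from its line, S and K(1) discharged** (the LINE OF RECORD as of p502821): σ-residual + G⁺ + K(2)ᶠⁱⁿ + K(3)ᶠⁱⁿ. [folklore] -/
theorem eternalSteeredRunTwo_of_fin2 (hTail : SteeredTailConclTwo) (hG : GeoDictFin)
    (hK2 : ∀ p : ℕ, p.Prime → NoEternalIsolatedRadicandChainFin p 2)
    (hK3 : ∀ p : ℕ, p.Prime → NoEternalIsolatedRadicandChainFin p 3) : EternalSteeredRunTwo :=
  eternalSteeredRunTwo_of_fin hTail hG tailCodimBound_holds hK2 hK3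


end SteeredTwo

end Summit.ResolutionOfSingularities.ResolutionOfSingularities.Theorems.SwitchingDichotomy.Words
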